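/-
Copyright (c) 2026 the pub-hodgecm-mathlib formalisation cell (harness21).  Prover seat hodgecm-mathlib-K2E3-p21 (g5), Track B «K2-LIT» ∕ h413
(`stmt-HodgeConjecture-24833`), line `K2_E3_EllipticInputs`, unit U12 §L, road «GL-[M6]-sc» (line lead K2E3-p23 (g5), RULINGS #5 (M5-4) ∕ #7 (M7-1) ∕ #8 (M8-2)),
brick B4-J, FILE 1 of 3: «THE UNIPOTENT RADICALS EMBED HOMEOMORPHICALLY AND CLOSEDLY IN `GL_n(F) ⧸ Λ·1`».  2026-09-04.
-/
import Summits.HodgeConjecture.HodgeConjecture.Theorems.K2E3GL3ModCocompactFrame        -- ★ (B2) p857849: the frame `G_Λ = GL₃(F) ⧸ Λ·1`; brings ★ B0a `…ModCocompactCentral`, ★ GL-P `…ModCentre`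
import Literature.NumberTheory.Automorphic.UnipotentRadicalCompactOpenProofs                 -- ★ `isClosed_unipotentRadicalGL`, `isLimitOfCompactOpen_unipotentRadicalGL`, `unipotentRadicalGL_le_upperUnitriangular`
import HarnessLib

/-!
# K2_E3 road (h413), road «GL-[M6]-sc», brick B4-J (file 1): a unipotent subgroup `U ≤ U_n(F)` of `GL_n(F)` maps HOMEOMORPHICALLY onto its image
# `N̄ = π_Λ(U)` in `G_Λ = GL_n(F) ⧸ Λ·1`, the product `U · Λ·1` is CLOSED, `N̄` is closed, `U ∩ C·Λ·1` is compact for `C` compact, and `N̄` is exhausted by an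
# increasing sequence of compact open subgroups (FILE 2)

Cell `pub/hodgecm-mathlib` (D-0151), Track B, seat K2E3-p21 (g5); line lead K2E3-p23 (g5) (RULINGS #8 (M8-2) 2026-09-04T06:36:41Z «B4-J = PACKAGING AT `G_Λ` … the
`N̄_c := (unipotentRadicalGL F c).map π_Λ` heads for B, P_{2,1}, P_{1,2} «=»; file it»), dealer K2E3-plan (g3).  `--supports stmt-HodgeConjecture-24833 --as helper`;
THEOREMS ONLY (no definition ∕ instance ∕ notation ∕ named-fact hypothesis ∕ `sorry`).  This file is the TOPOLOGICAL core of B4-J.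

NOTATION (spelled out in every statement; nothing is defined): `F` a field, `n : ℕ` with `[NeZero n]` where an entry `(0,0)` is read, `Λ₀ ≤ F^×` any subgroup,
`Λ·1 := Λ₀.map (GL.scalar (Fin n)) ≤ Z(GL_n(F))`, `G_Λ := GL (Fin n) F ⧸ Λ·1`, `π_Λ = QuotientGroup.mk' (Λ·1)`, `U ≤ upperUnitriangular (Fin n) F` a subgroup of
unipotent upper triangular matrices (e.g. the unipotent radical ★ `unipotentRadicalGL F c` of a standard parabolic with monotone block labelling `c`, ★
`unipotentRadicalGL_le_upperUnitriangular`), `N̄ := U.map π_Λ ≤ G_Λ`.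

THE MATHEMATICS (folklore; [HarishChandra1970, Part VII §3 p. 70: «`N ∩ Z = {1}`, so `N` may be regarded as a subgroup of `G ⧸ Z`»]; [Casselman1995, Prop. 1.4.4];
[BernsteinZelevinsky1976, §1.7]).  An element `g = u · (λ·1)` of `U · Λ·1` has `g₀₀ = λ` (the diagonal of `u` is `1`), so `λ` and `u = g · (g₀₀·1)⁻¹` are CONTINUOUS
functions of `g` on the open set `{g₀₀ ≠ 0}`, and `det g = λⁿ = g₀₀ⁿ` is a CLOSED condition forcing `g₀₀ ≠ 0`.  Hence: §1 (algebra) the decomposition of `U · Λ·1` is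
unique and `π_Λ` is injective on `U` (`eq_of_mk_eq_mk`); §2 (topology) **`isClosed_coe_mul_map_scalar`** (`U · Λ·1` closed for `U`, `Λ₀` closed),
**`isClosed_coe_map_mk'`** (`N̄` closed), **`exists_continuousMulEquiv_map_mk'`** (`∃ e : ↥U ≃ₜ* ↥N̄, ∀ u, ↑(e u) = π_Λ u`: `π_Λ` restricted to the saturated
`π_Λ⁻¹(N̄) = U · Λ·1` is an OPEN map onto `N̄`, Mathlib `IsOpenMap.restrictPreimage`, and `e(W) = π_Λ(r⁻¹ W)` for the continuous retraction `r`),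
**`isCompact_preimage_coe_mul_map_scalar`** (`{u ∈ U | u ∈ C · Λ·1}` is compact for `C` compact — what makes supercuspidal coefficients compactly supported
along `U`).  The sequence currency `N_j` (exhaustion of `U_c`, `N̄_c` by compact open subgroups) and the Haar consequences are FILE 2 `K2E3GLnUnipotentExhaustion`;
the representation theory (Harish-Chandra's criterion at `G_Λ`, cusp-form property of supercuspidal coefficients) is FILE 3 `K2E3GL3SupercuspidalJacquetVanishing`.

HONEST LABEL: HC_CM is proved only modulo the 7 printed citations (2 remaining named inputs: hLiu418 = `stmt-HodgeConjecture-24832`, h413 = `stmt-HodgeConjecture-24833`)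
until rung 0 closes; this file is a count-neutral helper and closes no socket.

## References
* [HarishChandra1970] Harish-Chandra (notes by G. van Dijk), *Harmonic Analysis on Reductive p-adic Groups*, LNM 162 (1970), Part I §3 p. 9, Part VII §3 p. 70.
* [Casselman1995] W. Casselman, *Introduction to the theory of admissible representations of `p`-adic reductive groups* (1995 notes), Prop. 1.4.4, Thm. 5.3.1.
* [BernsteinZelevinsky1976] I. N. Bernstein, A. V. Zelevinsky, *Representations of the group GL(n, F) where F is a non-archimedean local field*, Russian Math.
  Surveys 31:3 (1976), §1.7, Prop. 2.35.
* [PlatonovRapinchuk1994] V. Platonov, A. Rapinchuk, *Algebraic Groups and Number Theory* (1994), §3.3.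
-/

set_option autoImplicit false
-- the mandated namespace repeats the single-problem summit's segment (`HodgeConjecture.HodgeConjecture`)
set_option linter.dupNamespace false

noncomputable section

open Set Filter Topology
open scoped MatrixGroups Pointwise
open Literature.NumberTheory.Automorphic Literature.NumberTheory.GaloisRepresentations Literature.NumberTheory.GaloisRepresentations.IsNonarchimedeanLocalField

namespace Summit.HodgeConjecture.HodgeConjecture.Cruxes.H413.K2E3GLnUnipotentModScalars

/-! ## §1  Algebra of `U · Λ·1 ⊆ GL_n(F)` -/

section Algebra

variable {F : Type*} [Field F] {n : ℕ}

/-- The scalar matrix `λ·1` as a matrix: `λ • 1`. [folklore] -/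
theorem coe_scalar_eq_smul_one (c : Fˣ) :
    ((Matrix.GeneralLinearGroup.scalar (Fin n) c : GL (Fin n) F) : Matrix (Fin n) (Fin n) F) = (c : F) • (1 : Matrix (Fin n) (Fin n) F) := by
  simp [Matrix.GeneralLinearGroup.scalar, Matrix.smul_one_eq_diagonal]

/-- `g · (λ·1) = λ • g` on matrices. [folklore] -/
theorem coe_mul_scalar (g : GL (Fin n) F) (c : Fˣ) :
    ((g * Matrix.GeneralLinearGroup.scalar (Fin n) c : GL (Fin n) F) : Matrix (Fin n) (Fin n) F) = (c : F) • (g : Matrix (Fin n) (Fin n) F) := by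
  rw [Units.val_mul, coe_scalar_eq_smul_one, Matrix.mul_smul, mul_one]

/-- A unipotent upper triangular matrix has diagonal entries `1`. [cite: BernsteinZelevinsky1976, §1.7] -/
theorem apply_self_eq_one_of_mem {U : Subgroup (GL (Fin n) F)} (hU : U ≤ upperUnitriangular (Fin n) F) {u : GL (Fin n) F} (hu : u ∈ U) (i : Fin n) :
    (u : Matrix (Fin n) (Fin n) F) i i = 1 :=
  ((mem_upperUnitriangular_iff u).1 (hU hu)).2 i

/-- The diagonal of `u · (λ·1)` is `λ` for `u` unipotent upper triangular. [folklore] -/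
theorem mul_scalar_apply_self {U : Subgroup (GL (Fin n) F)} (hU : U ≤ upperUnitriangular (Fin n) F) {u : GL (Fin n) F} (hu : u ∈ U) (c : Fˣ) (i : Fin n) :
    ((u * Matrix.GeneralLinearGroup.scalar (Fin n) c : GL (Fin n) F) : Matrix (Fin n) (Fin n) F) i i = c := by
  rw [coe_mul_scalar, Matrix.smul_apply, apply_self_eq_one_of_mem hU hu i, smul_eq_mul, mul_one]

/-- `det (u · (λ·1)) = λⁿ` for `u` unipotent upper triangular (★ `det_eq_one_of_mem_upperUnitriangular`). [folklore] -/
theorem det_coe_mul_scalar {U : Subgroup (GL (Fin n) F)} (hU : U ≤ upperUnitriangular (Fin n) F) {u : GL (Fin n) F} (hu : u ∈ U) (c : Fˣ) :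
    ((u * Matrix.GeneralLinearGroup.scalar (Fin n) c : GL (Fin n) F) : Matrix (Fin n) (Fin n) F).det = (c : F) ^ n := by
  have hdet : (u : Matrix (Fin n) (Fin n) F).det = 1 := by
    have h := congrArg (fun x : Fˣ => (x : F)) (det_eq_one_of_mem_upperUnitriangular (hU hu))
    simpa [Matrix.GeneralLinearGroup.val_det_apply] using h
  rw [coe_mul_scalar, Matrix.det_smul, Fintype.card_fin, hdet, mul_one]

/-- `Λ·1 ≤ Z(GL_n(F))`, any `n` (★ B0a `map_scalar_le_center` is the `n = 3` reading). [cite: PlatonovRapinchuk1994, §3.3] -/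
theorem map_scalar_le_center (Λ₀ : Subgroup Fˣ) :
    Λ₀.map (Matrix.GeneralLinearGroup.scalar (Fin n)) ≤ Subgroup.center (GL (Fin n) F) := by
  rintro _ ⟨c, -, rfl⟩
  rw [Matrix.GeneralLinearGroup.center_eq_range_scalar]
  exact ⟨c, rfl⟩

/-- `Λ·1` is a normal subgroup of `GL_n(F)`, any `n` (★ B0a `normal_map_scalar` is the `n = 3` reading). [cite: PlatonovRapinchuk1994, §3.3] -/
theorem normal_map_scalar (Λ₀ : Subgroup Fˣ) : (Λ₀.map (Matrix.GeneralLinearGroup.scalar (Fin n))).Normal :=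
  ⟨fun z hz g => by
    have hcomm : g * z = z * g := Subgroup.mem_center_iff.1 (map_scalar_le_center Λ₀ hz) g
    rw [hcomm, mul_inv_cancel_right]
    exact hz⟩

/-- **Decomposition of `U · Λ·1`**: `g ∈ U · Λ·1 ↔ g = u · (λ·1)` with `u ∈ U`, `λ ∈ Λ₀`. [folklore] -/
theorem mem_coe_mul_map_scalar_iff (U : Subgroup (GL (Fin n) F)) (Λ₀ : Subgroup Fˣ) (g : GL (Fin n) F) :
    g ∈ (U : Set (GL (Fin n) F)) * (Λ₀.map (Matrix.GeneralLinearGroup.scalar (Fin n)) : Set (GL (Fin n) F)) ↔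
      ∃ u ∈ U, ∃ c ∈ Λ₀, g = u * Matrix.GeneralLinearGroup.scalar (Fin n) c := by
  constructor
  · rintro ⟨u, hu, z, hz, rfl⟩
    obtain ⟨c, hc, rfl⟩ := Subgroup.mem_map.1 hz
    exact ⟨u, hu, c, hc, rfl⟩
  · rintro ⟨u, hu, c, hc, rfl⟩
    exact Set.mem_mul.2 ⟨u, hu, _, Subgroup.mem_map_of_mem _ hc, rfl⟩

/-- **Uniqueness of the decomposition**: `u · (λ·1) = u' · (λ'·1)` with `u, u'` unipotent upper triangular forces `λ = λ'` (read the `(0,0)` entry) and `u = u'`.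
[cite: HarishChandra1970, Part VII §3 p. 70] -/
theorem eq_of_mul_scalar_eq_mul_scalar [NeZero n] {U : Subgroup (GL (Fin n) F)} (hU : U ≤ upperUnitriangular (Fin n) F) {u u' : GL (Fin n) F}
    (hu : u ∈ U) (hu' : u' ∈ U) {c c' : Fˣ}
    (h : u * Matrix.GeneralLinearGroup.scalar (Fin n) c = u' * Matrix.GeneralLinearGroup.scalar (Fin n) c') : c = c' ∧ u = u' := by
  have hc : c = c' := by
    refine Units.ext ?_
    rw [← mul_scalar_apply_self hU hu c 0, ← mul_scalar_apply_self hU hu' c' 0, h]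
  refine ⟨hc, ?_⟩
  rw [hc] at h
  exact mul_right_cancel h

/-- **`π_Λ` IS INJECTIVE ON `U`** (`U ∩ Λ·1 = 1`): `π_Λ u = π_Λ u'` for unipotent upper triangular `u, u'` forces `u = u'`. [cite: HarishChandra1970, Part VII §3 p. 70] -/
theorem eq_of_mk_eq_mk [NeZero n] {U : Subgroup (GL (Fin n) F)} (hU : U ≤ upperUnitriangular (Fin n) F) (Λ₀ : Subgroup Fˣ)
    [(Λ₀.map (Matrix.GeneralLinearGroup.scalar (Fin n))).Normal] {u u' : GL (Fin n) F} (hu : u ∈ U) (hu' : u' ∈ U)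
    (h : (QuotientGroup.mk u : GL (Fin n) F ⧸ Λ₀.map (Matrix.GeneralLinearGroup.scalar (Fin n))) = QuotientGroup.mk u') : u = u' := by
  obtain ⟨c, -, hc⟩ := Subgroup.mem_map.1 (QuotientGroup.eq.1 h)
  have h' : u * Matrix.GeneralLinearGroup.scalar (Fin n) c = u' * Matrix.GeneralLinearGroup.scalar (Fin n) 1 := by
    rw [hc, mul_inv_cancel_left, map_one, mul_one]
  exact (eq_of_mul_scalar_eq_mul_scalar hU hu hu' h').2

/-- The `(0,0)` entry of an element `g = u · (λ·1)` of `U · Λ·1` is the unit `λ`; in particular it is non-zero. [folklore] -/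
theorem apply_zero_zero_ne_zero_of_mem [NeZero n] {U : Subgroup (GL (Fin n) F)} (hU : U ≤ upperUnitriangular (Fin n) F) (Λ₀ : Subgroup Fˣ)
    {g : GL (Fin n) F} (hg : g ∈ (U : Set (GL (Fin n) F)) * (Λ₀.map (Matrix.GeneralLinearGroup.scalar (Fin n)) : Set (GL (Fin n) F))) :
    (g : Matrix (Fin n) (Fin n) F) 0 0 ≠ 0 := by
  obtain ⟨u, hu, c, -, rfl⟩ := (mem_coe_mul_map_scalar_iff U Λ₀ _).1 hg
  rw [mul_scalar_apply_self hU hu c 0]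
  exact c.ne_zero

/-- **The retraction** `g ↦ g · (g₀₀·1)⁻¹` recovers `u` from `g = u · (λ·1)` (and `g₀₀ = λ`). [folklore] -/
theorem mul_scalar_mk0_inv_eq [NeZero n] {U : Subgroup (GL (Fin n) F)} (hU : U ≤ upperUnitriangular (Fin n) F) {u : GL (Fin n) F} (hu : u ∈ U) (c : Fˣ)
    (h0 : ((u * Matrix.GeneralLinearGroup.scalar (Fin n) c : GL (Fin n) F) : Matrix (Fin n) (Fin n) F) 0 0 ≠ 0) :
    Units.mk0 _ h0 = c ∧
      u * Matrix.GeneralLinearGroup.scalar (Fin n) c * (Matrix.GeneralLinearGroup.scalar (Fin n) (Units.mk0 _ h0))⁻¹ = u := by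
  have hc : Units.mk0 _ h0 = c := Units.ext (by rw [Units.val_mk0, mul_scalar_apply_self hU hu c 0])
  exact ⟨hc, by rw [hc, mul_inv_cancel_right]⟩

end Algebra

/-! ## §2  Topology: `U · Λ·1` is closed, `U ≃ₜ* N̄`, compactness of `U ∩ C · Λ·1`, exhaustion of `N̄` -/

section Topology

variable {F : Type*} [Field F]

/-- `λ ↦ λ·1 : F^× → GL_n(F)` is continuous, any `n` (★ B0a `continuous_scalar` is `n = 3`). [folklore] -/
theorem continuous_scalar [TopologicalSpace F] [IsTopologicalRing F] {n : ℕ} :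
    Continuous (Matrix.GeneralLinearGroup.scalar (Fin n) : Fˣ → GL (Fin n) F) := by
  refine Units.continuous_iff.2 ⟨?_, ?_⟩
  · exact (Units.continuous_val.smul continuous_const : Continuous fun c : Fˣ => (c : F) • (1 : Matrix (Fin n) (Fin n) F)).congr
      fun c => (coe_scalar_eq_smul_one c).symm
  · refine (Units.continuous_coe_inv.smul continuous_const : Continuous fun c : Fˣ => ((c⁻¹ : Fˣ) : F) • (1 : Matrix (Fin n) (Fin n) F)).congr
      fun c => ?_
    show ((c⁻¹ : Fˣ) : F) • (1 : Matrix (Fin n) (Fin n) F) = (((Matrix.GeneralLinearGroup.scalar (Fin n) c)⁻¹ : GL (Fin n) F) : Matrix (Fin n) (Fin n) F)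
    rw [← map_inv, coe_scalar_eq_smul_one]

variable [ValuativeRel F] [TopologicalSpace F] [IsNonarchimedeanLocalField F] {n : ℕ}

/-- **`U · Λ·1` IS CLOSED IN `GL_n(F)`** for `U ≤ U_n(F)` closed and `Λ₀ ≤ F^×` closed.  The set lies in the closed set `D = {g | g₀₀ⁿ = det g}` (as
`det (u·λ·1) = λⁿ = (u·λ·1)₀₀ⁿ`), which lies in the open set `O = {g | g₀₀ ≠ 0}`; on `O` the map `Ψ : g ↦ (g·(g₀₀·1)⁻¹, g₀₀) ∈ GL_n(F) × F^×` is continuous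
and `U · Λ·1 = Ψ⁻¹(U × Λ₀)` is relatively closed; so `closure (U · Λ·1) ⊆ D ⊆ O` meets `O` inside `U · Λ·1`. [cite: HarishChandra1970, Part VII §3 p. 70] -/
theorem isClosed_coe_mul_map_scalar [NeZero n] {U : Subgroup (GL (Fin n) F)} (hU : U ≤ upperUnitriangular (Fin n) F) (hUc : IsClosed (U : Set (GL (Fin n) F)))
    (Λ₀ : Subgroup Fˣ) (hΛ : IsClosed (Λ₀ : Set Fˣ)) :
    IsClosed ((U : Set (GL (Fin n) F)) * (Λ₀.map (Matrix.GeneralLinearGroup.scalar (Fin n)) : Set (GL (Fin n) F))) := by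
  haveI : T2Space F := (isLocalField F).toT2Space
  haveI : ContinuousInv₀ F := (isLocalField F).toIsTopologicalDivisionRing.toContinuousInv₀
  set S : Set (GL (Fin n) F) := (U : Set (GL (Fin n) F)) * (Λ₀.map (Matrix.GeneralLinearGroup.scalar (Fin n)) : Set (GL (Fin n) F)) with hS
  -- the entry `g₀₀` and the determinant are continuous on `GL_n(F)`
  have h00 : Continuous fun g : GL (Fin n) F => (g : Matrix (Fin n) (Fin n) F) 0 0 := Units.continuous_val.matrix_elem 0 0
  have hdet : Continuous fun g : GL (Fin n) F => (g : Matrix (Fin n) (Fin n) F).det := Units.continuous_val.matrix_det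
  -- the open set `O` and the closed set `D`, `S ⊆ D ⊆ O`
  set O : Set (GL (Fin n) F) := {g | (g : Matrix (Fin n) (Fin n) F) 0 0 ≠ 0} with hO
  set D : Set (GL (Fin n) F) := {g | ((g : Matrix (Fin n) (Fin n) F) 0 0) ^ n = (g : Matrix (Fin n) (Fin n) F).det} with hD
  have hDc : IsClosed D := isClosed_eq (h00.pow n) hdet
  have hSD : S ⊆ D := by
    intro g hg
    obtain ⟨u, hu, c, -, rfl⟩ := (mem_coe_mul_map_scalar_iff U Λ₀ g).1 hg
    show ((u * Matrix.GeneralLinearGroup.scalar (Fin n) c : GL (Fin n) F) : Matrix (Fin n) (Fin n) F) 0 0 ^ n =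
      ((u * Matrix.GeneralLinearGroup.scalar (Fin n) c : GL (Fin n) F) : Matrix (Fin n) (Fin n) F).det
    rw [mul_scalar_apply_self hU hu c 0, det_coe_mul_scalar hU hu c]
  have hDO : D ⊆ O := by
    intro g hg h0
    have hg' : ((g : Matrix (Fin n) (Fin n) F) 0 0) ^ n = (g : Matrix (Fin n) (Fin n) F).det := hg
    rw [h0, zero_pow (NeZero.ne n)] at hg'
    have hu : IsUnit (g : Matrix (Fin n) (Fin n) F).det := (Matrix.isUnit_iff_isUnit_det _).1 (Units.isUnit g)
    exact hu.ne_zero hg'.symm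
  -- `S = O ∩ closure S`: `S` is the preimage of the closed `U × Λ₀` under the continuous retraction pair `Ψ` on `O`
  have hψc : Continuous fun g : O => (Units.mk0 (((g : GL (Fin n) F) : Matrix (Fin n) (Fin n) F) 0 0) g.2 : Fˣ) := by
    refine Units.continuous_iff.2 ⟨?_, ?_⟩
    · exact h00.comp continuous_subtype_val
    · refine ((h00.comp continuous_subtype_val).inv₀ fun g : O => g.2).congr fun g => ?_
      show ((((g : GL (Fin n) F) : Matrix (Fin n) (Fin n) F) 0 0))⁻¹ = (((Units.mk0 (((g : GL (Fin n) F) : Matrix (Fin n) (Fin n) F) 0 0) g.2)⁻¹ : Fˣ) : F)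
      rw [Units.val_inv_eq_inv_val, Units.val_mk0]
  have hΨc : Continuous fun g : O => ((g : GL (Fin n) F) * (Matrix.GeneralLinearGroup.scalar (Fin n)
      (Units.mk0 (((g : GL (Fin n) F) : Matrix (Fin n) (Fin n) F) 0 0) g.2))⁻¹, Units.mk0 (((g : GL (Fin n) F) : Matrix (Fin n) (Fin n) F) 0 0) g.2) :=
    (continuous_subtype_val.mul (continuous_scalar.comp hψc).inv).prodMk hψc
  set T : Set O := (fun g : O => ((g : GL (Fin n) F) * (Matrix.GeneralLinearGroup.scalar (Fin n)
      (Units.mk0 (((g : GL (Fin n) F) : Matrix (Fin n) (Fin n) F) 0 0) g.2))⁻¹, Units.mk0 (((g : GL (Fin n) F) : Matrix (Fin n) (Fin n) F) 0 0) g.2)) ⁻¹'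
    ((U : Set (GL (Fin n) F)) ×ˢ (Λ₀ : Set Fˣ)) with hT
  have hTc : IsClosed T := (hUc.prod hΛ).preimage hΨc
  have hST : S = Subtype.val '' T := by
    ext g
    constructor
    · intro hg
      have hgO : g ∈ O := hDO (hSD hg)
      obtain ⟨u, hu, c, hc, rfl⟩ := (mem_coe_mul_map_scalar_iff U Λ₀ g).1 hg
      obtain ⟨h1, h2⟩ := mul_scalar_mk0_inv_eq hU hu c hgO
      refine ⟨⟨_, hgO⟩, ?_, rfl⟩
      show (_, _) ∈ (U : Set (GL (Fin n) F)) ×ˢ (Λ₀ : Set Fˣ)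
      rw [h2, h1]
      exact ⟨hu, hc⟩
    · rintro ⟨g, hg, rfl⟩
      obtain ⟨hu, hc⟩ := hg
      refine (mem_coe_mul_map_scalar_iff U Λ₀ _).2 ⟨_, hu, _, hc, ?_⟩
      rw [inv_mul_cancel_right]
  have hSO : closure S ∩ O ⊆ S := by
    rintro g ⟨hg, hgO⟩
    have hT' : T = Subtype.val ⁻¹' closure (Subtype.val '' T) := by
      rw [← Topology.IsInducing.subtypeVal.closure_eq_preimage_closure_image, hTc.closure_eq]
    rw [hST]
    refine ⟨⟨g, hgO⟩, ?_, rfl⟩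
    rw [hT']
    show g ∈ closure (Subtype.val '' T)
    rwa [← hST]
  refine closure_subset_iff_isClosed.1 fun g hg => hSO ⟨hg, hDO (hDc.closure_subset_iff.2 hSD hg)⟩

/-- **`N̄ = π_Λ(U)` IS CLOSED IN `G_Λ`** (`U ≤ U_n(F)` closed, `Λ₀` closed): its preimage `U · Λ·1` under the quotient map is closed. [cite: HarishChandra1970, Part VII §3 p. 70] -/
theorem isClosed_coe_map_mk' [NeZero n] {U : Subgroup (GL (Fin n) F)} (hU : U ≤ upperUnitriangular (Fin n) F) (hUc : IsClosed (U : Set (GL (Fin n) F)))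
    (Λ₀ : Subgroup Fˣ) (hΛ : IsClosed (Λ₀ : Set Fˣ)) [(Λ₀.map (Matrix.GeneralLinearGroup.scalar (Fin n))).Normal] :
    IsClosed ((U.map (QuotientGroup.mk' (Λ₀.map (Matrix.GeneralLinearGroup.scalar (Fin n)))) :
      Set (GL (Fin n) F ⧸ Λ₀.map (Matrix.GeneralLinearGroup.scalar (Fin n))))) := by
  refine ((QuotientGroup.isQuotientMap_mk (Λ₀.map (Matrix.GeneralLinearGroup.scalar (Fin n)))).isClosed_preimage).1 ?_
  rw [Subgroup.coe_map, QuotientGroup.coe_mk', QuotientGroup.preimage_image_mk_eq_mul]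
  exact isClosed_coe_mul_map_scalar hU hUc Λ₀ hΛ

omit [ValuativeRel F] [TopologicalSpace F] [IsNonarchimedeanLocalField F] in
/-- The elements of `π_Λ⁻¹(N̄) = U · Λ·1`, read with their `(0,0)` entry: `g = u · (λ·1)` with `u ∈ U`, `λ = g₀₀ ∈ Λ₀`. [folklore] -/
theorem exists_eq_mul_scalar_of_mk_mem_map [NeZero n] {U : Subgroup (GL (Fin n) F)} (hU : U ≤ upperUnitriangular (Fin n) F) (Λ₀ : Subgroup Fˣ)
    [(Λ₀.map (Matrix.GeneralLinearGroup.scalar (Fin n))).Normal] {g : GL (Fin n) F}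
    (hg : (QuotientGroup.mk g : GL (Fin n) F ⧸ Λ₀.map (Matrix.GeneralLinearGroup.scalar (Fin n))) ∈
      U.map (QuotientGroup.mk' (Λ₀.map (Matrix.GeneralLinearGroup.scalar (Fin n))))) :
    ∃ h0 : (g : Matrix (Fin n) (Fin n) F) 0 0 ≠ 0, ∃ u ∈ U, Units.mk0 _ h0 ∈ Λ₀ ∧
      g = u * Matrix.GeneralLinearGroup.scalar (Fin n) (Units.mk0 _ h0) := by
  have hg' : g ∈ (U : Set (GL (Fin n) F)) * (Λ₀.map (Matrix.GeneralLinearGroup.scalar (Fin n)) : Set (GL (Fin n) F)) := by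
    rw [← QuotientGroup.preimage_image_mk_eq_mul, ← QuotientGroup.coe_mk', ← Subgroup.coe_map]
    exact hg
  have h0 := apply_zero_zero_ne_zero_of_mem hU Λ₀ hg'
  obtain ⟨u, hu, c, hc, rfl⟩ := (mem_coe_mul_map_scalar_iff U Λ₀ g).1 hg'
  obtain ⟨h1, -⟩ := mul_scalar_mk0_inv_eq hU hu c h0
  refine ⟨h0, u, hu, ?_, ?_⟩
  · rw [h1]; exact hc
  · rw [h1]

/-- **`U ≃ₜ* N̄ = π_Λ(U)`: THE QUOTIENT MAP RESTRICTS TO AN ISOMORPHISM OF TOPOLOGICAL GROUPS FROM `U` ONTO ITS IMAGE IN `G_Λ = GL_n(F) ⧸ Λ·1`.**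
Bijectivity: `U ∩ Λ·1 = 1` (`eq_of_mk_eq_mk`).  Continuity of the inverse: `π_Λ` restricted to the saturated set `π_Λ⁻¹(N̄) = U · Λ·1` is an OPEN map onto
`N̄` (restriction of an open map to a preimage), and the image of an open `W ⊆ U` is `π_Λ(r⁻¹(W))` for the continuous retraction `r : U · Λ·1 → U`,
`g ↦ g · (g₀₀·1)⁻¹`. [cite: HarishChandra1970, Part VII §3 p. 70] [cite: BernsteinZelevinsky1976, §1.7] -/
theorem exists_continuousMulEquiv_map_mk' [NeZero n] {U : Subgroup (GL (Fin n) F)} (hU : U ≤ upperUnitriangular (Fin n) F) (Λ₀ : Subgroup Fˣ)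
    [(Λ₀.map (Matrix.GeneralLinearGroup.scalar (Fin n))).Normal] :
    ∃ e : ↥U ≃ₜ* ↥(U.map (QuotientGroup.mk' (Λ₀.map (Matrix.GeneralLinearGroup.scalar (Fin n))))),
      ∀ u : ↥U, ((e u : ↥(U.map (QuotientGroup.mk' (Λ₀.map (Matrix.GeneralLinearGroup.scalar (Fin n)))))) :
        GL (Fin n) F ⧸ Λ₀.map (Matrix.GeneralLinearGroup.scalar (Fin n))) = QuotientGroup.mk (u : GL (Fin n) F) := by
  haveI : T2Space F := (isLocalField F).toT2Space
  haveI : ContinuousInv₀ F := (isLocalField F).toIsTopologicalDivisionRing.toContinuousInv₀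
  set NΛ : Subgroup (GL (Fin n) F) := Λ₀.map (Matrix.GeneralLinearGroup.scalar (Fin n)) with hNΛ
  set Nbar : Subgroup (GL (Fin n) F ⧸ NΛ) := U.map (QuotientGroup.mk' NΛ) with hNbar
  -- the bijective homomorphism `U → N̄`
  set f : ↥U →* ↥Nbar := (QuotientGroup.mk' NΛ).subgroupMap U with hf
  have hf_coe : ∀ u : ↥U, ((f u : ↥Nbar) : GL (Fin n) F ⧸ NΛ) = QuotientGroup.mk (u : GL (Fin n) F) := fun u => rfl
  have hfinj : Function.Injective f := fun u u' h =>
    Subtype.ext (eq_of_mk_eq_mk hU Λ₀ u.2 u'.2 (by rw [← hf_coe, ← hf_coe, h]))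
  set E : ↥U ≃* ↥Nbar := MulEquiv.ofBijective f ⟨hfinj, (QuotientGroup.mk' NΛ).subgroupMap_surjective U⟩ with hE
  have hE_coe : ∀ u : ↥U, ((E u : ↥Nbar) : GL (Fin n) F ⧸ NΛ) = QuotientGroup.mk (u : GL (Fin n) F) := fun u => rfl
  have hEc : Continuous E :=
    continuous_induced_rng.2 (QuotientGroup.continuous_mk.comp continuous_subtype_val :
      Continuous fun u : ↥U => (QuotientGroup.mk (u : GL (Fin n) F) : GL (Fin n) F ⧸ NΛ))
  -- the saturated set `P = π⁻¹(N̄)` and the retraction `r : P → U`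
  set P : Set (GL (Fin n) F) := (QuotientGroup.mk : GL (Fin n) F → GL (Fin n) F ⧸ NΛ) ⁻¹' (Nbar : Set (GL (Fin n) F ⧸ NΛ)) with hP
  have hne : ∀ g : P, ((g : GL (Fin n) F) : Matrix (Fin n) (Fin n) F) 0 0 ≠ 0 := fun g => (exists_eq_mul_scalar_of_mk_mem_map hU Λ₀ g.2).1
  have hdec : ∀ g : P, ∃ u ∈ U, Units.mk0 _ (hne g) ∈ Λ₀ ∧ (g : GL (Fin n) F) = u * Matrix.GeneralLinearGroup.scalar (Fin n) (Units.mk0 _ (hne g)) :=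
    fun g => (exists_eq_mul_scalar_of_mk_mem_map hU Λ₀ g.2).2
  have hr_mem : ∀ g : P, (g : GL (Fin n) F) * (Matrix.GeneralLinearGroup.scalar (Fin n) (Units.mk0 _ (hne g)))⁻¹ ∈ U := by
    intro g
    obtain ⟨u, hu, -, hgu⟩ := hdec g
    have h : (g : GL (Fin n) F) * (Matrix.GeneralLinearGroup.scalar (Fin n) (Units.mk0 _ (hne g)))⁻¹ = u := by
      rw [mul_inv_eq_iff_eq_mul]; exact hgu
    rw [h]; exact hu
  set r : P → ↥U := fun g => ⟨(g : GL (Fin n) F) * (Matrix.GeneralLinearGroup.scalar (Fin n) (Units.mk0 _ (hne g)))⁻¹, hr_mem g⟩ with hr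
  have hrc : Continuous r := by
    refine Continuous.subtype_mk ?_ _
    have h00 : Continuous fun g : P => ((g : GL (Fin n) F) : Matrix (Fin n) (Fin n) F) 0 0 :=
      (Units.continuous_val.matrix_elem 0 0).comp continuous_subtype_val
    have hc : Continuous fun g : P => (Units.mk0 _ (hne g) : Fˣ) := by
      refine Units.continuous_iff.2 ⟨h00, (h00.inv₀ fun g => hne g).congr fun g => ?_⟩
      show ((((g : GL (Fin n) F)) : Matrix (Fin n) (Fin n) F) 0 0)⁻¹ = (((Units.mk0 _ (hne g))⁻¹ : Fˣ) : F)
      rw [Units.val_inv_eq_inv_val, Units.val_mk0]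
    exact continuous_subtype_val.mul (continuous_scalar.comp hc).inv
  have hr_mk : ∀ g : P, (QuotientGroup.mk ((r g : ↥U) : GL (Fin n) F) : GL (Fin n) F ⧸ NΛ) = QuotientGroup.mk (g : GL (Fin n) F) := by
    intro g
    obtain ⟨u, -, hΛ, hgu⟩ := hdec g
    show (QuotientGroup.mk ((g : GL (Fin n) F) * (Matrix.GeneralLinearGroup.scalar (Fin n) (Units.mk0 _ (hne g)))⁻¹) : GL (Fin n) F ⧸ NΛ) =
      QuotientGroup.mk (g : GL (Fin n) F)
    rw [QuotientGroup.eq, mul_inv_rev, inv_inv, inv_mul_cancel_right]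
    exact Subgroup.mem_map_of_mem _ hΛ
  -- `E` is an open map: `E(W) = π|(r⁻¹ W)` with `π| : π⁻¹(N̄) → N̄` open
  have hEo : IsOpenMap E := by
    intro W hW
    have himg : (E : ↥U → ↥Nbar) '' W = (Nbar : Set (GL (Fin n) F ⧸ NΛ)).restrictPreimage (QuotientGroup.mk : GL (Fin n) F → GL (Fin n) F ⧸ NΛ) '' (r ⁻¹' W) := by
      ext x
      constructor
      · rintro ⟨u, huW, rfl⟩
        have huN : (QuotientGroup.mk (u : GL (Fin n) F) : GL (Fin n) F ⧸ NΛ) ∈ (Nbar : Set (GL (Fin n) F ⧸ NΛ)) := (E u).2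
        have hru : r ⟨(u : GL (Fin n) F), huN⟩ = u :=
          Subtype.ext (eq_of_mk_eq_mk hU Λ₀ (r ⟨(u : GL (Fin n) F), huN⟩).2 u.2 (hr_mk ⟨(u : GL (Fin n) F), huN⟩))
        exact ⟨⟨(u : GL (Fin n) F), huN⟩, by rw [Set.mem_preimage, hru]; exact huW, Subtype.ext rfl⟩
      · rintro ⟨g, hg, rfl⟩
        refine ⟨r g, hg, Subtype.ext ?_⟩
        rw [hE_coe, hr_mk]
        rfl
    rw [himg]
    exact (QuotientGroup.isOpenMap_coe.restrictPreimage _) _ (hW.preimage hrc)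
  let H : ↥U ≃ₜ ↥Nbar := E.toEquiv.toHomeomorphOfContinuousOpen hEc hEo
  exact ⟨{ E with continuous_toFun := hEc, continuous_invFun := H.continuous_symm }, hE_coe⟩

/-- **`U ∩ C · Λ·1` IS COMPACT for `C ⊆ GL_n(F)` compact** (`U ≤ U_n(F)` closed, `Λ₀` closed): read in `↥U`, the set `{u | u ∈ C · Λ·1}` is the preimage under
the homeomorphism `U ≃ₜ* N̄` of `N̄ ∩ π_Λ(C)`, compact since `N̄` is closed.  This is what makes a «compactly supported modulo `Λ·1`» function on `GL_n(F)`
compactly supported along `U`. [cite: HarishChandra1970, Part I §3 p. 9] [cite: Casselman1995, Prop. 1.4.4] -/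
theorem isCompact_preimage_coe_mul_map_scalar [NeZero n] {U : Subgroup (GL (Fin n) F)} (hU : U ≤ upperUnitriangular (Fin n) F)
    (hUc : IsClosed (U : Set (GL (Fin n) F))) (Λ₀ : Subgroup Fˣ) (hΛ : IsClosed (Λ₀ : Set Fˣ)) {C : Set (GL (Fin n) F)} (hC : IsCompact C) :
    IsCompact ((Subtype.val : ↥U → GL (Fin n) F) ⁻¹' (C * (Λ₀.map (Matrix.GeneralLinearGroup.scalar (Fin n)) : Set (GL (Fin n) F)))) := by
  haveI := normal_map_scalar (n := n) Λ₀
  obtain ⟨e, he⟩ := exists_continuousMulEquiv_map_mk' hU Λ₀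
  have hNc := isClosed_coe_map_mk' hU hUc Λ₀ hΛ
  have hset : (Subtype.val : ↥U → GL (Fin n) F) ⁻¹' (C * (Λ₀.map (Matrix.GeneralLinearGroup.scalar (Fin n)) : Set (GL (Fin n) F))) =
      e ⁻¹' ((Subtype.val : ↥(U.map (QuotientGroup.mk' (Λ₀.map (Matrix.GeneralLinearGroup.scalar (Fin n))))) →
        GL (Fin n) F ⧸ Λ₀.map (Matrix.GeneralLinearGroup.scalar (Fin n))) ⁻¹'
          ((QuotientGroup.mk : GL (Fin n) F → GL (Fin n) F ⧸ Λ₀.map (Matrix.GeneralLinearGroup.scalar (Fin n))) '' C)) := by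
    ext u
    simp only [Set.mem_preimage, he]
    rw [← QuotientGroup.preimage_image_mk_eq_mul (Λ₀.map (Matrix.GeneralLinearGroup.scalar (Fin n))) C]
    rfl
  rw [hset]
  exact e.toHomeomorph.isCompact_preimage.2 (hNc.isClosedEmbedding_subtypeVal.isCompact_preimage (hC.image QuotientGroup.continuous_mk))

end Topology

end Summit.HodgeConjecture.HodgeConjecture.Cruxes.H413.K2E3GLnUnipotentModScalars

end
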